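import Mathlib.LinearAlgebra.BilinearForm.Properties
import Mathlib.Algebra.Group.Subgroup.Map
import Literature.AlgebraicGeometry.HodgeTheory.SkewVanishingLattice

/-!
# Route LinearSystemTorelli — crux `LocalTubeSpan`: transvection calculus in `Rep` form

Helper file (`--supports stmt-HodgeConjecture-2490`, line `Sketch`, stubs `stub_conjTransvection`,
`stub_isometryOfGenerators` and the image-of-`G` plumbing of `stub_radicalCore`).  Local and global
monodromy groups of the hyperplane-section family act on the vanishing cohomology
`V = H^{2p-1}(X_s, ℚ)_van` (alternating intersection form `B`) through Picard–Lefschetz transvections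
`T_δ(x) = x - B(x, δ) δ` ([Schnell2010] §5, §7; Voisin II Thm. 3.16).  Recorded here, for a monoid
hom `ρ : G →* End V` whose generators act by such transvections:

* `localTubeSpan_isometry_of_transvection_formula` — `T_δ` is an isometry of an alternating `B`;
* `localTubeSpan_isometry_of_generators` — a group generated by isometries acts by isometries;
* `localTubeSpan_conj_transvection_formula` — `g T_δ g⁻¹ = T_{g·δ}` for isometric `g` (conjugate
  meridians act along the transported cycles: how "every `T_δ`, `δ ∈ Δ = G·{δ_t}`, is realised in
  `G`" is discharged from orbit data);
* `localTubeSpan_range_sub_id_le_span_of_formula` — `(T_δ - 1)V ⊆ ℚδ` (rank one);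
* `localTubeSpan_range_toHomUnits_eq_transvectionGroup` (+ two membership corollaries) — if the
  generators act as `T_δ`, `δ ∈ Δ`, and every such `T_δ` is realised, the image of `G` in `GL(V)`
  is exactly the monodromy group `Γ_Δ = transvectionGroup B Δ` of
  `Literature.AlgebraicGeometry.HodgeTheory.SkewVanishingLattice` ([Schnell2010] §7, sentence
  before Prop. 12).

Reference: C. Schnell, *Primitive cohomology and the tube mapping*, Math. Z. 268 (2010)
(= arXiv:0711.3927) §7.  Elementary; no named facts.
-/

-- `Summit.HodgeConjecture.HodgeConjecture.Theorems` is the mandated namespace (single-conjunct summit: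
-- Sub = Summit), which `linter.dupNamespace` flags on every declaration; the lakefile turns the
-- linter off tree-wide (weak option), restated here so stand-alone elaboration is warning-free too.
set_option linter.dupNamespace false

noncomputable section

open Literature.AlgebraicGeometry.HodgeTheory

namespace Summit.HodgeConjecture.HodgeConjecture.Theorems

/-! ### Transvection calculus -/

section Calculus

variable {K V : Type*} [CommRing K] [AddCommGroup V] [Module K V] (B : LinearMap.BilinForm K V)

/-- A Picard–Lefschetz transvection `T(x) = x - B(x, δ) δ` of an ALTERNATING form is an isometry:
`B(Tx, Ty) = B(x, y) - B(x, δ)(B(y, δ) + B(δ, y)) + B(x, δ)B(y, δ)B(δ, δ) = B(x, y)`. [folklore] -/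
theorem localTubeSpan_isometry_of_transvection_formula (hB : B.IsAlt) (δ : V) (T : V →ₗ[K] V)
    (hT : ∀ x, T x = x - B x δ • δ) (x y : V) : B (T x) (T y) = B x y := by
  have h1 : B δ δ = 0 := hB.self_eq_zero δ
  have h2 : B δ y = -B y δ := (hB.neg_eq y δ).symm
  rw [hT x, hT y]
  simp only [map_sub, map_smul, LinearMap.sub_apply, LinearMap.smul_apply, smul_eq_mul, h1, h2]
  ring

variable {G : Type*} [Group G] (ρ : G →* (V →ₗ[K] V))

/-- A group generated by isometries of `B` acts by isometries. [folklore] -/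
theorem localTubeSpan_isometry_of_generators (s : Set G) (hs : Subgroup.closure s = ⊤)
    (hiso : ∀ t ∈ s, ∀ x y, B (ρ t x) (ρ t y) = B x y) (g : G) (x y : V) :
    B (ρ g x) (ρ g y) = B x y := by
  have hg : g ∈ Subgroup.closure s := by rw [hs]; exact Subgroup.mem_top g
  induction hg using Subgroup.closure_induction generalizing x y with
  | mem t ht => exact hiso t ht x y
  | one => simp
  | mul g h _ _ ihg ihh => rw [map_mul, Module.End.mul_apply, Module.End.mul_apply, ihg, ihh]
  | inv g _ ih =>
      have := ih (ρ g⁻¹ x) (ρ g⁻¹ y)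
      rw [← Module.End.mul_apply, ← Module.End.mul_apply, ← map_mul, mul_inv_cancel, map_one,
        Module.End.one_apply, Module.End.one_apply] at this
      exact this.symm

/-- **Conjugate meridians act as transvections along the transported cycles**: if `G` acts by
isometries and `t` acts as `T_δ`, then `g t g⁻¹` acts as `T_{g·δ}`.  (This is how the hypothesis
"every `T_δ`, `δ ∈ Δ = G·{δ_t}`, is realised by an element of `G`" of the detection theorems is
discharged from orbit data.) [cite: Schnell2010, §7 (Skew-symmetric vanishing lattices)] -/
theorem localTubeSpan_conj_transvection_formula (hiso : ∀ (g : G) (x y : V), B (ρ g x) (ρ g y) = B x y)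
    (g t : G) (δ : V) (ht : ∀ x, ρ t x = x - B x δ • δ) (x : V) :
    ρ (g * t * g⁻¹) x = x - B x (ρ g δ) • ρ g δ := by
  have e1 : B (ρ g⁻¹ x) δ = B x (ρ g δ) := by
    rw [← hiso g (ρ g⁻¹ x) δ, ← Module.End.mul_apply, ← map_mul, mul_inv_cancel, map_one,
      Module.End.one_apply]
  rw [map_mul, map_mul, Module.End.mul_apply, Module.End.mul_apply, ht, map_sub, map_smul, e1,
    ← Module.End.mul_apply, ← map_mul, mul_inv_cancel, map_one, Module.End.one_apply]

/-- `(T - 1)V ⊆ K·δ` for `T(x) = x - B(x, δ)δ`. [folklore] -/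
theorem localTubeSpan_range_sub_id_le_span_of_formula (δ : V) (T : V →ₗ[K] V)
    (hT : ∀ x, T x = x - B x δ • δ) :
    LinearMap.range (T - LinearMap.id) ≤ K ∙ δ := by
  rintro _ ⟨x, rfl⟩
  rw [LinearMap.sub_apply, LinearMap.id_apply, hT, sub_sub_cancel_left, ← neg_smul]
  exact Submodule.smul_mem _ _ (Submodule.mem_span_singleton_self δ)

end Calculus

/-! ### The image of the group in `GL`: generators ↦ transvections -/

section Image

variable {G : Type*} [Group G] {W : Type*} [AddCommGroup W] [Module ℚ W]

/-- If the generators of `G` act through `ρ'` as transvections along members of `Δ` and every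
`T_δ`, `δ ∈ Δ`, is realised by some element of `G`, then the image of `G` in `GL(W)` is exactly
the monodromy group `Γ_Δ`. [cite: Schnell2010, §7 (before Prop. 12: "the image of `G` in `Sp♯(V)`
is exactly the monodromy group `Γ_Δ`")] -/
theorem localTubeSpan_range_toHomUnits_eq_transvectionGroup (BW : LinearMap.BilinForm ℚ W)
    (ΔW : Set W) (ρ' : G →* (W →ₗ[ℚ] W)) (s : Set G) (hs : Subgroup.closure s = ⊤)
    (hsT : ∀ t ∈ s, ∃ δ ∈ ΔW, ρ' t = skewTransvection BW δ)
    (hreal : ∀ δ ∈ ΔW, ∃ g : G, ρ' g = skewTransvection BW δ) :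
    ρ'.toHomUnits.range = transvectionGroup BW ΔW := by
  apply le_antisymm
  · rw [MonoidHom.range_eq_map, ← hs, MonoidHom.map_closure]
    refine (Subgroup.closure_le _).2 ?_
    rintro _ ⟨t, ht, rfl⟩
    obtain ⟨δ, hδ, hρ⟩ := hsT t ht
    exact Subgroup.subset_closure ⟨δ, hδ, by rw [MonoidHom.coe_toHomUnits, hρ]⟩
  · unfold transvectionGroup
    refine (Subgroup.closure_le _).2 ?_
    rintro u ⟨δ, hδ, hu⟩
    obtain ⟨g, hg⟩ := hreal δ hδ
    exact ⟨g, Units.ext (by rw [MonoidHom.coe_toHomUnits, hg, hu])⟩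

/-- Under the same hypotheses every element of `G` acts by an element of `Γ_Δ`. [folklore] -/
theorem localTubeSpan_toHomUnits_mem_transvectionGroup (BW : LinearMap.BilinForm ℚ W)
    (ΔW : Set W) (ρ' : G →* (W →ₗ[ℚ] W)) (s : Set G) (hs : Subgroup.closure s = ⊤)
    (hsT : ∀ t ∈ s, ∃ δ ∈ ΔW, ρ' t = skewTransvection BW δ)
    (hreal : ∀ δ ∈ ΔW, ∃ g : G, ρ' g = skewTransvection BW δ) (g : G) :
    ρ'.toHomUnits g ∈ transvectionGroup BW ΔW := by
  rw [← localTubeSpan_range_toHomUnits_eq_transvectionGroup BW ΔW ρ' s hs hsT hreal]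
  exact ⟨g, rfl⟩

/-- Under the same hypotheses every element of `Γ_Δ` is the action of some element of `G`.
[folklore] -/
theorem localTubeSpan_exists_toHomUnits_eq_of_mem_transvectionGroup (BW : LinearMap.BilinForm ℚ W)
    (ΔW : Set W) (ρ' : G →* (W →ₗ[ℚ] W)) (s : Set G) (hs : Subgroup.closure s = ⊤)
    (hsT : ∀ t ∈ s, ∃ δ ∈ ΔW, ρ' t = skewTransvection BW δ)
    (hreal : ∀ δ ∈ ΔW, ∃ g : G, ρ' g = skewTransvection BW δ)
    {γ : (W →ₗ[ℚ] W)ˣ} (hγ : γ ∈ transvectionGroup BW ΔW) : ∃ g : G, ρ' g = γ := by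
  rw [← localTubeSpan_range_toHomUnits_eq_transvectionGroup BW ΔW ρ' s hs hsT hreal] at hγ
  obtain ⟨g, hg⟩ := hγ
  exact ⟨g, by rw [← hg, MonoidHom.coe_toHomUnits]⟩

end Image

end Summit.HodgeConjecture.HodgeConjecture.Theorems

end
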